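import Mathlib
import HarnessLib
import Literature.Probability.LatticeModels.IsingLimitLaw
import Literature.Probability.LatticeModels.IsingLimitLawTilt
import Literature.Probability.LatticeModels.IsingLimitLawLaplace
import Literature.Analysis.Complex.PolyaBesselKernel
import Summits.RiemannHypothesis.RiemannHypothesis.Theorems.LeeYangLeeyangPolyaKernelIsingLimitDefs

/-!
# Convergence of the Euler scheme: stub `stub_euler` of the line `telegraph-bessel-chain` (crux stmt-RiemannHypothesis-0453)

Along the witness chains (`η_k = mesh k`, `N_k = nBonds k`, horizon `T_k = horizon k = log (k+2)`,
sites `t_m = siteTime k m = (N_k - m) η_k`) the transfer recursion `X_{m+1} = sdStep (iyη) c_m X_m`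
started from `X_0 = (2cosh(iyη), 2sinh(iyη))` is compared with the sampled continuum solution
`Y_m = (S t_m, D t_m)`, which satisfies the same recursion up to a local error `≤ L η² e^{t_m}` in
each component (hypothesis `hloc`).

The stability estimate is done in the `φ± = S ± D` basis with the `ℓ¹` quantity
`F(V) = ‖V.1 + V.2‖ + ‖V.1 - V.2‖`: one has `(sdStep x c V).1 ± (sdStep x c V).2
= e^{±x} (V.1 ± c V.2)`, so for purely imaginary `x` and `|c| ≤ 1` the linear map `sdStep x c` does
not increase `F` (`V.1 + cV.2` and `V.1 - cV.2` are the doubly-stochastic mixtures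
`(1±c)/2 · (V.1+V.2) + (1∓c)/2 · (V.1-V.2)`). Hence `F(X_N - Y_N) ≤ F(X_0 - Y_0) + 4 Σ_{m<N} L η² e^{t_m}
≤ F(X_0 - Y_0) + 4 L T_k η_k e^{T_k}`, and `T_k η_k e^{T_k} = T_k²/(k+2)⁴ → 0`, while the terminal
error `F(X_0 - Y_0) ≤ 2‖2cosh(iyη_k) - 2‖ + 2‖S(T_k) - 2‖ + 2‖2sinh(iyη_k)‖ + 2|y|/(a e^{T_k}) → 0`
(`η_k → 0`, `T_k → ∞`, `S(T) → 2`). Finally `‖X_N.1 - S 0‖ ≤ F(X_N - Y_N)` since `t_{N} = 0`.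
Folklore (Lax equivalence: consistency + stability ⇒ convergence, for a linear one-step scheme).
-/

noncomputable section

namespace Summit.RiemannHypothesis.RiemannHypothesis.Theorems.LeeYangTelegraph

open MeasureTheory Filter Topology Complex
open Literature.Probability.LatticeModels Literature.Analysis.Complex.Polya1926

/-! ### The `ℓ¹`-in-the-`φ±`-basis stability of `sdStep` -/

/-- `‖u‖ ≤ ‖u + v‖ + ‖u - v‖` (from `2u = (u+v) + (u-v)`). [folklore] -/
private lemma norm_le_pm (u v : ℂ) : ‖u‖ ≤ ‖u + v‖ + ‖u - v‖ := by
  have h2 : (2 : ℝ) * ‖u‖ ≤ ‖u + v‖ + ‖u - v‖ := by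
    calc (2 : ℝ) * ‖u‖ = ‖(u + v) + (u - v)‖ := by
          rw [show (u + v) + (u - v) = 2 * u by ring, norm_mul, Complex.norm_two]
      _ ≤ ‖u + v‖ + ‖u - v‖ := norm_add_le _ _
  linarith [norm_nonneg u]

/-- `‖u + v‖ + ‖u - v‖ ≤ 2‖u‖ + 2‖v‖`. [folklore] -/
private lemma pm_le (u v : ℂ) : ‖u + v‖ + ‖u - v‖ ≤ 2 * ‖u‖ + 2 * ‖v‖ := by
  linarith [norm_add_le u v, norm_sub_le u v]

/-- Doubly-stochastic mixing: for `c ∈ [-1, 1]`,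
`‖u + c v‖ + ‖u - c v‖ ≤ ‖u + v‖ + ‖u - v‖`. [folklore] -/
private lemma pm_diag_le (c : ℝ) (hc0 : -1 ≤ c) (hc1 : c ≤ 1) (u v : ℂ) :
    ‖u + c * v‖ + ‖u - c * v‖ ≤ ‖u + v‖ + ‖u - v‖ := by
  have hp : 0 ≤ (1 + c) / 2 := by linarith
  have hm : 0 ≤ (1 - c) / 2 := by linarith
  have e1 : u + c * v =
      (((1 + c) / 2 : ℝ) : ℂ) * (u + v) + (((1 - c) / 2 : ℝ) : ℂ) * (u - v) := by
    push_cast; ring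
  have e2 : u - c * v =
      (((1 - c) / 2 : ℝ) : ℂ) * (u + v) + (((1 + c) / 2 : ℝ) : ℂ) * (u - v) := by
    push_cast; ring
  have n1 : ‖u + c * v‖ ≤ (1 + c) / 2 * ‖u + v‖ + (1 - c) / 2 * ‖u - v‖ := by
    rw [e1]
    refine (norm_add_le _ _).trans (le_of_eq ?_)
    rw [norm_mul, norm_mul, Complex.norm_real, Complex.norm_real, Real.norm_of_nonneg hp,
      Real.norm_of_nonneg hm]
  have n2 : ‖u - c * v‖ ≤ (1 - c) / 2 * ‖u + v‖ + (1 + c) / 2 * ‖u - v‖ := by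
    rw [e2]
    refine (norm_add_le _ _).trans (le_of_eq ?_)
    rw [norm_mul, norm_mul, Complex.norm_real, Complex.norm_real, Real.norm_of_nonneg hp,
      Real.norm_of_nonneg hm]
  calc ‖u + c * v‖ + ‖u - c * v‖ ≤ _ := add_le_add n1 n2
    _ = ‖u + v‖ + ‖u - v‖ := by ring

/-- For purely imaginary `x` and `c ∈ [-1, 1]`, `sdStep x c` does not increase
`‖V.1 + V.2‖ + ‖V.1 - V.2‖`: in the `φ±` basis it is `diag(e^{x}, e^{-x})` after a doubly-stochastic
mixing. [folklore] -/
private lemma sdStep_pm_le (x : ℂ) (hx : x.re = 0) (c : ℝ) (hc0 : -1 ≤ c) (hc1 : c ≤ 1)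
    (V : ℂ × ℂ) :
    ‖(sdStep x c V).1 + (sdStep x c V).2‖ + ‖(sdStep x c V).1 - (sdStep x c V).2‖ ≤
      ‖V.1 + V.2‖ + ‖V.1 - V.2‖ := by
  have h1 : (sdStep x c V).1 + (sdStep x c V).2 = Complex.exp x * (V.1 + c * V.2) := by
    rw [← Complex.cosh_add_sinh]; simp only [sdStep]; ring
  have h2 : (sdStep x c V).1 - (sdStep x c V).2 = Complex.exp (-x) * (V.1 - c * V.2) := by
    rw [← Complex.cosh_sub_sinh]; simp only [sdStep]; ring
  rw [h1, h2, norm_mul, norm_mul, Complex.norm_exp, Complex.norm_exp, Complex.neg_re, hx, neg_zero,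
    Real.exp_zero, one_mul, one_mul]
  exact pm_diag_le c hc0 hc1 V.1 V.2

/-- `sdStep x c` is linear: it commutes with differences. [folklore] -/
private lemma sdStep_sub (x : ℂ) (c : ℝ) (U V : ℂ × ℂ) :
    sdStep x c U - sdStep x c V = sdStep x c (U - V) := by
  ext <;> simp only [sdStep, Prod.fst_sub, Prod.snd_sub] <;> ring

/-- Subadditivity of `V ↦ ‖V.1 + V.2‖ + ‖V.1 - V.2‖` on `ℂ × ℂ`. [folklore] -/
private lemma pm_add_le (U W : ℂ × ℂ) :
    ‖(U + W).1 + (U + W).2‖ + ‖(U + W).1 - (U + W).2‖ ≤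
      (‖U.1 + U.2‖ + ‖U.1 - U.2‖) + (‖W.1 + W.2‖ + ‖W.1 - W.2‖) := by
  simp only [Prod.fst_add, Prod.snd_add]
  have e1 : U.1 + W.1 + (U.2 + W.2) = (U.1 + U.2) + (W.1 + W.2) := by ring
  have e2 : U.1 + W.1 - (U.2 + W.2) = (U.1 - U.2) + (W.1 - W.2) := by ring
  rw [e1, e2]
  linarith [norm_add_le (U.1 + U.2) (W.1 + W.2), norm_add_le (U.1 - U.2) (W.1 - W.2)]

/-- **Stability of the contracting linear recursion**: if `X_{m+1} = sdStep x c_m X_m` (purely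
imaginary `x`, `c_m ∈ [-1,1]`) and `Y` satisfies the same recursion up to errors `ε_m` in each
component, then `F(X_n - Y_n) ≤ F(X_0 - Y_0) + 4 Σ_{m<n} ε_m` for
`F(V) = ‖V.1 + V.2‖ + ‖V.1 - V.2‖`. [folklore] -/
private lemma euler_accum (x : ℂ) (hx : x.re = 0) (c : ℕ → ℝ) (hc : ∀ m, -1 ≤ c m ∧ c m ≤ 1)
    (X Y : ℕ → ℂ × ℂ) (ε : ℕ → ℝ) (hX : ∀ m, X (m + 1) = sdStep x (c m) (X m)) :
    ∀ n : ℕ, (∀ m < n, ‖(Y (m + 1)).1 - (sdStep x (c m) (Y m)).1‖ ≤ ε m ∧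
        ‖(Y (m + 1)).2 - (sdStep x (c m) (Y m)).2‖ ≤ ε m) →
      ‖(X n - Y n).1 + (X n - Y n).2‖ + ‖(X n - Y n).1 - (X n - Y n).2‖ ≤
        ‖(X 0 - Y 0).1 + (X 0 - Y 0).2‖ + ‖(X 0 - Y 0).1 - (X 0 - Y 0).2‖ +
          4 * ∑ m ∈ Finset.range n, ε m := by
  intro n
  induction n with
  | zero => intro _; simp
  | succ n ih =>
    intro hY
    have ih' := ih (fun m hm => hY m (Nat.lt_succ_of_lt hm))
    obtain ⟨hY1, hY2⟩ := hY n (Nat.lt_succ_self n)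
    have hdec : X (n + 1) - Y (n + 1) =
        sdStep x (c n) (X n - Y n) + (sdStep x (c n) (Y n) - Y (n + 1)) := by
      rw [hX n, ← sdStep_sub]; abel
    have h1 := pm_add_le (sdStep x (c n) (X n - Y n)) (sdStep x (c n) (Y n) - Y (n + 1))
    have h2 := sdStep_pm_le x hx (c n) (hc n).1 (hc n).2 (X n - Y n)
    have h3 := pm_le (sdStep x (c n) (Y n) - Y (n + 1)).1 (sdStep x (c n) (Y n) - Y (n + 1)).2
    have h4 : ‖(sdStep x (c n) (Y n) - Y (n + 1)).1‖ ≤ ε n := by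
      rw [Prod.fst_sub, norm_sub_rev]; exact hY1
    have h5 : ‖(sdStep x (c n) (Y n) - Y (n + 1)).2‖ ≤ ε n := by
      rw [Prod.snd_sub, norm_sub_rev]; exact hY2
    rw [Finset.sum_range_succ, hdec]
    linarith

/-! ### Arithmetic of the witness sequence -/

/-- `2 ≤ k + 2`. [folklore] -/
private lemma two_le_cast (k : ℕ) : (2 : ℝ) ≤ (k : ℝ) + 2 := by
  have := (Nat.cast_nonneg k : (0 : ℝ) ≤ k); linarith

/-- `N_k = (k+2)^5` as a real number. [folklore] -/
private lemma nBonds_cast (k : ℕ) : (nBonds k : ℝ) = ((k : ℝ) + 2) ^ 5 := by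
  simp [nBonds]

/-- `0 < N_k`. [folklore] -/
private lemma nBonds_pos (k : ℕ) : (0 : ℝ) < nBonds k := by
  rw [nBonds_cast]; positivity

/-- `0 < T_k = log(k+2)`. [folklore] -/
private lemma horizon_pos (k : ℕ) : 0 < horizon k :=
  Real.log_pos (by linarith [two_le_cast k])

/-- `T_k ≤ k + 2`. [folklore] -/
private lemma horizon_le (k : ℕ) : horizon k ≤ (k : ℝ) + 2 := by
  have := Real.log_le_sub_one_of_pos (show (0 : ℝ) < k + 2 by positivity)
  unfold horizon; linarith

/-- `e^{T_k} = k + 2`. [folklore] -/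
private lemma exp_horizon (k : ℕ) : Real.exp (horizon k) = (k : ℝ) + 2 := by
  unfold horizon; exact Real.exp_log (by positivity)

/-- `0 < η_k`. [folklore] -/
private lemma mesh_pos (k : ℕ) : 0 < mesh k :=
  div_pos (horizon_pos k) (nBonds_pos k)

/-- `N_k η_k = T_k`. [folklore] -/
private lemma nBonds_mul_mesh (k : ℕ) : (nBonds k : ℝ) * mesh k = horizon k := by
  have h := (nBonds_pos k).ne'
  unfold mesh; field_simp

/-- `η_k ≤ 1/(k+2)`. [folklore] -/
private lemma mesh_le_inv (k : ℕ) : mesh k ≤ 1 / ((k : ℝ) + 2) := by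
  unfold mesh
  rw [nBonds_cast, div_le_div_iff₀ (by positivity) (by positivity), one_mul]
  have hx : (2 : ℝ) ≤ (k : ℝ) + 2 := two_le_cast k
  calc horizon k * ((k : ℝ) + 2) ≤ ((k : ℝ) + 2) * ((k : ℝ) + 2) :=
        mul_le_mul_of_nonneg_right (horizon_le k) (by positivity)
    _ = ((k : ℝ) + 2) ^ 2 := by ring
    _ ≤ ((k : ℝ) + 2) ^ 5 := pow_le_pow_right₀ (by linarith) (by norm_num)

/-- `η_k ≤ 1`. [folklore] -/
private lemma mesh_le_one (k : ℕ) : mesh k ≤ 1 :=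
  (mesh_le_inv k).trans (by rw [div_le_one (by positivity)]; linarith [two_le_cast k])

/-- `T_k η_k e^{T_k} ≤ 1/(k+2)`. [folklore] -/
private lemma horizon_mesh_exp_le (k : ℕ) :
    horizon k * mesh k * Real.exp (horizon k) ≤ 1 / ((k : ℝ) + 2) := by
  rw [exp_horizon]
  unfold mesh
  rw [nBonds_cast]
  have hx : (2 : ℝ) ≤ (k : ℝ) + 2 := two_le_cast k
  have hT := horizon_le k
  have hT0 := (horizon_pos k).le
  rw [show horizon k * (horizon k / ((k : ℝ) + 2) ^ 5) * ((k : ℝ) + 2) =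
      horizon k * horizon k * ((k : ℝ) + 2) / ((k : ℝ) + 2) ^ 5 by ring,
    div_le_div_iff₀ (by positivity) (by positivity), one_mul]
  calc horizon k * horizon k * ((k : ℝ) + 2) * ((k : ℝ) + 2)
        = (horizon k * horizon k) * (((k : ℝ) + 2) * ((k : ℝ) + 2)) := by ring
    _ ≤ (((k : ℝ) + 2) * ((k : ℝ) + 2)) * (((k : ℝ) + 2) * ((k : ℝ) + 2)) :=
        mul_le_mul_of_nonneg_right (mul_le_mul hT hT hT0 (by positivity)) (by positivity)
    _ = ((k : ℝ) + 2) ^ 4 := by ring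
    _ ≤ ((k : ℝ) + 2) ^ 5 := pow_le_pow_right₀ (by linarith) (by norm_num)

/-- `t_0 = T_k`. [folklore] -/
private lemma siteTime_zero (k : ℕ) : siteTime k 0 = horizon k := by
  unfold siteTime; rw [Nat.cast_zero, sub_zero]; exact nBonds_mul_mesh k

/-- `t_{N_k} = 0`. [folklore] -/
private lemma siteTime_nBonds (k : ℕ) : siteTime k (nBonds k) = 0 := by
  unfold siteTime; rw [sub_self, zero_mul]

/-- `t_m - η_k = t_{m+1}`. [folklore] -/
private lemma siteTime_succ (k m : ℕ) : siteTime k m - mesh k = siteTime k (m + 1) := by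
  unfold siteTime; push_cast; ring

/-- `η_k ≤ t_m` for `m < N_k`. [folklore] -/
private lemma mesh_le_siteTime (k m : ℕ) (hm : m < nBonds k) : mesh k ≤ siteTime k m := by
  unfold siteTime
  have h1 : (1 : ℝ) ≤ (nBonds k : ℝ) - m := by
    have h : m + 1 ≤ nBonds k := hm
    have h' := (Nat.cast_le (α := ℝ)).mpr h
    push_cast at h'; linarith
  calc mesh k = 1 * mesh k := (one_mul _).symm
    _ ≤ ((nBonds k : ℝ) - m) * mesh k := mul_le_mul_of_nonneg_right h1 (mesh_pos k).le

/-- `t_m ≤ T_k`. [folklore] -/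
private lemma siteTime_le_horizon (k m : ℕ) : siteTime k m ≤ horizon k := by
  unfold siteTime
  calc ((nBonds k : ℝ) - m) * mesh k ≤ (nBonds k : ℝ) * mesh k :=
        mul_le_mul_of_nonneg_right (sub_le_self _ (Nat.cast_nonneg m)) (mesh_pos k).le
    _ = horizon k := nBonds_mul_mesh k

/-! ### The error bound for chain `k` and the limit -/

/-- **Error bound for chain `k`**: `‖X_N.1 - S 0‖ ≤` (terminal error terms) `+ 4 L T_k η_k e^{T_k}`.
[folklore] -/
private lemma euler_bound (a y : ℝ) (ha : 0 < a) (S D : ℝ → ℂ) (L : ℝ) (hL : 0 ≤ L)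
    (hloc : ∀ η t : ℝ, 0 < η → η ≤ 1 → η ≤ t →
      ‖S (t - η) - (sdStep (I * y * η) (Real.exp (-(2 * η * flipRate a (t - η)))) (S t, D t)).1‖
          ≤ L * η ^ 2 * Real.exp t ∧
      ‖D (t - η) - (sdStep (I * y * η) (Real.exp (-(2 * η * flipRate a (t - η)))) (S t, D t)).2‖
          ≤ L * η ^ 2 * Real.exp t)
    (hDb : ∀ t : ℝ, ‖D t‖ ≤ |y| / (a * Real.exp t))
    (hr1 : ∀ t : ℝ, a * Real.exp t ≤ flipRate a t) (k : ℕ) :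
    ‖(sdIter (I * y) (fun _ => mesh k) (bondTanh a k) (nBonds k)).1 - S 0‖ ≤
      2 * (‖2 * Complex.cosh (I * y * mesh k) - 2‖ + ‖S (horizon k) - 2‖) +
      2 * (‖2 * Complex.sinh (I * y * mesh k)‖ + |y| / (a * Real.exp (horizon k))) +
      4 * (L * (horizon k * mesh k * Real.exp (horizon k))) := by
  have hη0 : 0 < mesh k := mesh_pos k
  have hη1 : mesh k ≤ 1 := mesh_le_one k
  set X : ℕ → ℂ × ℂ := sdIter (I * y) (fun _ => mesh k) (bondTanh a k) with hX
  set Y : ℕ → ℂ × ℂ := fun m => (S (siteTime k m), D (siteTime k m)) with hY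
  have hXs : ∀ m, X (m + 1) = sdStep (I * y * mesh k) (bondTanh a k m) (X m) := fun m => rfl
  have hc : ∀ m, -1 ≤ bondTanh a k m ∧ bondTanh a k m ≤ 1 := fun m => by
    have hpos : 0 < bondTanh a k m := Real.exp_pos _
    refine ⟨by linarith, ?_⟩
    unfold bondTanh
    rw [Real.exp_le_one_iff, neg_nonpos]
    have h := hr1 (siteTime k (m + 1))
    have h' : 0 < flipRate a (siteTime k (m + 1)) := lt_of_lt_of_le (by positivity) h
    exact mul_nonneg (mul_nonneg zero_le_two hη0.le) h'.le
  have hx : (I * y * mesh k : ℂ).re = 0 := by simp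
  have hYb : ∀ m < nBonds k,
      ‖(Y (m + 1)).1 - (sdStep (I * y * mesh k) (bondTanh a k m) (Y m)).1‖ ≤
          L * mesh k ^ 2 * Real.exp (siteTime k m) ∧
      ‖(Y (m + 1)).2 - (sdStep (I * y * mesh k) (bondTanh a k m) (Y m)).2‖ ≤
          L * mesh k ^ 2 * Real.exp (siteTime k m) := by
    intro m hm
    have h := hloc (mesh k) (siteTime k m) hη0 hη1 (mesh_le_siteTime k m hm)
    rw [siteTime_succ] at h
    exact h
  have key := euler_accum (I * y * mesh k) hx (bondTanh a k) hc X Y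
    (fun m => L * mesh k ^ 2 * Real.exp (siteTime k m)) hXs (nBonds k) hYb
  -- the accumulated local errors
  have hsum : ∑ m ∈ Finset.range (nBonds k), L * mesh k ^ 2 * Real.exp (siteTime k m) ≤
      L * (horizon k * mesh k * Real.exp (horizon k)) := by
    calc ∑ m ∈ Finset.range (nBonds k), L * mesh k ^ 2 * Real.exp (siteTime k m)
          ≤ ∑ m ∈ Finset.range (nBonds k), L * mesh k ^ 2 * Real.exp (horizon k) := by
          refine Finset.sum_le_sum fun m _ => ?_
          exact mul_le_mul_of_nonneg_left (Real.exp_le_exp.mpr (siteTime_le_horizon k m))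
            (by positivity)
      _ = (nBonds k : ℝ) * (L * mesh k ^ 2 * Real.exp (horizon k)) := by
          rw [Finset.sum_const, Finset.card_range, nsmul_eq_mul]
      _ = L * (((nBonds k : ℝ) * mesh k) * mesh k * Real.exp (horizon k)) := by ring
      _ = L * (horizon k * mesh k * Real.exp (horizon k)) := by rw [nBonds_mul_mesh]
  -- the terminal error
  have h0 : ‖(X 0 - Y 0).1 + (X 0 - Y 0).2‖ + ‖(X 0 - Y 0).1 - (X 0 - Y 0).2‖ ≤
      2 * (‖2 * Complex.cosh (I * y * mesh k) - 2‖ + ‖S (horizon k) - 2‖) +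
      2 * (‖2 * Complex.sinh (I * y * mesh k)‖ + |y| / (a * Real.exp (horizon k))) := by
    have e1 : (X 0 - Y 0).1 = 2 * Complex.cosh (I * y * mesh k) - S (horizon k) := by
      show (X 0).1 - (Y 0).1 = _
      rw [show (X 0).1 = 2 * Complex.cosh (I * y * mesh k) from rfl,
        show (Y 0).1 = S (siteTime k 0) from rfl, siteTime_zero]
    have e2 : (X 0 - Y 0).2 = 2 * Complex.sinh (I * y * mesh k) - D (horizon k) := by
      show (X 0).2 - (Y 0).2 = _
      rw [show (X 0).2 = 2 * Complex.sinh (I * y * mesh k) from rfl,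
        show (Y 0).2 = D (siteTime k 0) from rfl, siteTime_zero]
    rw [e1, e2]
    have t1 := pm_le (2 * Complex.cosh (I * y * mesh k) - S (horizon k))
      (2 * Complex.sinh (I * y * mesh k) - D (horizon k))
    have t2 : ‖2 * Complex.cosh (I * y * mesh k) - S (horizon k)‖ ≤
        ‖2 * Complex.cosh (I * y * mesh k) - 2‖ + ‖S (horizon k) - 2‖ := by
      calc _ ≤ ‖2 * Complex.cosh (I * y * mesh k) - 2‖ + ‖2 - S (horizon k)‖ :=
            norm_sub_le_norm_sub_add_norm_sub _ _ _
        _ = _ := by rw [norm_sub_rev (2 : ℂ) (S (horizon k))]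
    have t3 : ‖2 * Complex.sinh (I * y * mesh k) - D (horizon k)‖ ≤
        ‖2 * Complex.sinh (I * y * mesh k)‖ + |y| / (a * Real.exp (horizon k)) :=
      (norm_sub_le _ _).trans (add_le_add le_rfl (hDb _))
    linarith
  -- the first component at the near end `t = 0`
  have hfst : ‖(X (nBonds k)).1 - S 0‖ ≤
      ‖(X (nBonds k) - Y (nBonds k)).1 + (X (nBonds k) - Y (nBonds k)).2‖ +
        ‖(X (nBonds k) - Y (nBonds k)).1 - (X (nBonds k) - Y (nBonds k)).2‖ := by
    have e : (X (nBonds k)).1 - S 0 = (X (nBonds k) - Y (nBonds k)).1 := by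
      show _ = (X (nBonds k)).1 - (Y (nBonds k)).1
      rw [show (Y (nBonds k)).1 = S (siteTime k (nBonds k)) from rfl, siteTime_nBonds]
    rw [e]; exact norm_le_pm _ _
  linarith

/-- STUB `stub_euler` (L). **Convergence of the Euler scheme**: along the witness chains
(`η_k = mesh k`, `N_k = nBonds k`, horizon `T_k = log(k+2)`, so `η_k T_k e^{T_k} → 0`), the transfer
recursion at `z = iy` — a product of maps that do not increase `‖S + D‖ + ‖S - D‖` — started from
`(2cos yη, 2i sin yη)` at `t = T_k` tracks the continuum solution down to `t = 0`: terminal error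
`→ 0` because `S(T_k) → 2`, `D(T_k) → 0`, `η_k → 0`; accumulated local error
`≤ 4 L η_k T_k e^{T_k} → 0`. [folklore] -/
theorem stub_euler (a y : ℝ) (ha : 0 < a) (S D : ℝ → ℂ) (L : ℝ)
    (hloc : ∀ η t : ℝ, 0 < η → η ≤ 1 → η ≤ t →
      ‖S (t - η) - (sdStep (I * y * η) (Real.exp (-(2 * η * flipRate a (t - η)))) (S t, D t)).1‖
          ≤ L * η ^ 2 * Real.exp t ∧
      ‖D (t - η) - (sdStep (I * y * η) (Real.exp (-(2 * η * flipRate a (t - η)))) (S t, D t)).2‖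
          ≤ L * η ^ 2 * Real.exp t)
    (hS : Tendsto S atTop (𝓝 2)) (hDb : ∀ t : ℝ, ‖D t‖ ≤ |y| / (a * Real.exp t))
    (hr1 : ∀ t : ℝ, a * Real.exp t ≤ flipRate a t) :
    Tendsto (fun k => (sdIter (I * y) (fun _ => mesh k) (bondTanh a k) (nBonds k)).1)
      atTop (𝓝 (S 0)) := by
  -- `L ≥ 0` (the local error bound is a norm bound)
  have hL : 0 ≤ L := by
    have h := (norm_nonneg _).trans (hloc 1 1 one_pos le_rfl le_rfl).1
    rw [one_pow, mul_one] at h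
    exact (mul_nonneg_iff_of_pos_right (Real.exp_pos 1)).mp h
  -- the elementary limits
  have hk2 : Tendsto (fun k : ℕ => (k : ℝ) + 2) atTop atTop :=
    tendsto_atTop_add_const_right _ _ tendsto_natCast_atTop_atTop
  have hinv : Tendsto (fun k : ℕ => 1 / ((k : ℝ) + 2)) atTop (𝓝 0) :=
    tendsto_const_nhds.div_atTop hk2
  have hT : Tendsto (fun k : ℕ => horizon k) atTop atTop := Real.tendsto_log_atTop.comp hk2
  have hmesh : Tendsto (fun k : ℕ => mesh k) atTop (𝓝 0) :=
    squeeze_zero (fun k => (mesh_pos k).le) mesh_le_inv hinv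
  have hacc : Tendsto (fun k : ℕ => horizon k * mesh k * Real.exp (horizon k)) atTop (𝓝 0) :=
    squeeze_zero (fun k => by
        have := (horizon_pos k).le; have := (mesh_pos k).le; positivity)
      horizon_mesh_exp_le hinv
  have hx : Tendsto (fun k : ℕ => I * y * (mesh k : ℂ)) atTop (𝓝 0) := by
    have h1 : Tendsto (fun k : ℕ => ((mesh k : ℝ) : ℂ)) atTop (𝓝 ((0 : ℝ) : ℂ)) :=
      (Complex.continuous_ofReal.tendsto 0).comp hmesh
    simpa using h1.const_mul (I * y)
  have hcosh : Tendsto (fun k : ℕ => ‖2 * Complex.cosh (I * y * mesh k) - 2‖) atTop (𝓝 0) := by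
    have h := ((Complex.continuous_cosh.tendsto 0).comp hx).const_mul 2
    simp only [Function.comp_def, Complex.cosh_zero, mul_one] at h
    exact tendsto_iff_norm_sub_tendsto_zero.mp h
  have hsinh : Tendsto (fun k : ℕ => ‖2 * Complex.sinh (I * y * mesh k)‖) atTop (𝓝 0) := by
    have h := ((Complex.continuous_sinh.tendsto 0).comp hx).const_mul 2
    simp only [Function.comp_def, Complex.sinh_zero, mul_zero] at h
    simpa using h.norm
  have hST : Tendsto (fun k : ℕ => ‖S (horizon k) - 2‖) atTop (𝓝 0) :=
    tendsto_iff_norm_sub_tendsto_zero.mp (hS.comp hT)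
  have hD : Tendsto (fun k : ℕ => |y| / (a * Real.exp (horizon k))) atTop (𝓝 0) :=
    tendsto_const_nhds.div_atTop ((Real.tendsto_exp_atTop.comp hT).const_mul_atTop ha)
  have hB : Tendsto (fun k : ℕ =>
      2 * (‖2 * Complex.cosh (I * y * mesh k) - 2‖ + ‖S (horizon k) - 2‖) +
      2 * (‖2 * Complex.sinh (I * y * mesh k)‖ + |y| / (a * Real.exp (horizon k))) +
      4 * (L * (horizon k * mesh k * Real.exp (horizon k)))) atTop (𝓝 0) := by
    have h := (((hcosh.add hST).const_mul 2).add ((hsinh.add hD).const_mul 2)).add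
      ((hacc.const_mul L).const_mul 4)
    simpa using h
  rw [tendsto_iff_norm_sub_tendsto_zero]
  exact squeeze_zero (fun k => norm_nonneg _)
    (fun k => euler_bound a y ha S D L hL hloc hDb hr1 k) hB

end Summit.RiemannHypothesis.RiemannHypothesis.Theorems.LeeYangTelegraph

end
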